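import Summits.BirchSwinnertonDyer.BirchSwinnertonDyer.Theorems.EisensteinPrimesMazurMCOnCellBTwistbackConnectedPartnerClassData
import HarnessLib

/-!
# Crux 3 `MazurMCOnCellB` (stmt-BirchSwinnertonDyer-19033), line `twistback` v12 — THE REGISTERED STUB 6⁷ AS A SUPPLY
# STATEMENT: its «¬ sub-row» hypothesis is idle modulo PUBLISHED facts, and it holds at a pair as soon as its conclusion is
# displayed at ANY vertex the pair's zig-zags reach

Width seat bsd-line-x2-p1-w3 (gen 16), cell `bsd-eis`, 2026-08-28; lane F2h (sequel of F2g
`…TwistbackConnectedPartnerClassData`). `--supports stmt-BirchSwinnertonDyer-19033 --as helper`. HONEST FRAMING: THEOREMS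
ONLY (no `def`, no named fact introduced, no `sorry`); §1 is fact-free one way and CONDITIONAL on PUBLISHED named facts
(`PublishedInputs` = item -19037, Disegni 2020 Thm. 4(1), Greenberg–Vatsal (3.11), Disegni 2020 Thm. 2.4,
Nakagawa–Horie–Taya) the other way; §2 is conditional on modularity (`nonempty_modularParametrizationData`) only; closes no
registered stub; proves NO supply — the statement `S` below is the registered open content of the line, OPEN in print on
every sub-population; no summit statement / Mazur main conjecture / case of BSD is proved; 0 cells / stubs / tiers move.

## What

`T` := the statement of twistback v12's registered stub `stub_offSubrow_connectedShaUnitOrPartner` (6⁷), VERBATIM (LEAD g15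
mirror `Lines-twistback.v12.lean` sha256 540948e0…, l.878–919): at every X2b pair `(W, p)` OFF the closed sub-row
(`p = 3`, `3` non-split, a rational `3`-line datum of local balance one) the class of `W` is connected by a zig-zag of
certified two-steps to a Ш-unit class OR to a partnered vertex. `S` := the same with the sub-row hypothesis DROPPED
(«every X2b pair is Ш-unit-connected or partner-connected»). Both spelled inline; no `def`.

* §1 `stub67_of_supply` — `S → T` (fact-free, weakening); `supply_of_stub67` — `T → S` given the PUBLISHED facts: on the
  sub-row x2-p1-w3 g11's p661280 (via p679233 §3 `connectedPartner_of_subrow`) supplies a partner AT the pair, i.e. the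
  right disjunct with the empty zig-zag; `supply_iff_stub67` — the record `S ↔ T` modulo PUBLISHED facts: the registered
  open content of the line is exactly `S`.
* §2 `stub67_of_forall_exists_zigzag` — `T` follows from «every X2b pair off the sub-row REACHES, along a zig-zag, SOME
  globally minimal vertex at which the disjunction holds» (F2g §2 `connectedShaUnit_or_connectedPartner_of_zigzag`;
  `hmodN`): the per-component form of the registered stub — one display per connected component of the class graph on
  X2b (a Ш-unit end, an order-one anchor via p679233 §2, a sub-row member, a partner at a pair) is what remains to supply.

References: tree p661280, p674224, p679233, F2g; LEAD g15 v12 announce (HOME STATUS 2026-08-28T23:50:31Z), RECORD #120;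
[GreenbergVatsal2000] §3 Thm. (3.11); [NakagawaHorie1988] Thm. 1; [Disegni2020] §2.2 Thm. 2.4, §3.2 Thm. 4; [MilneADT2006] I.7.3.
-/

set_option autoImplicit false
set_option linter.dupNamespace false -- `Summit.BirchSwinnertonDyer.BirchSwinnertonDyer.…`: summit = sub-problem name

noncomputable section

open scoped Classical MatrixGroups ModularForm

open CongruenceSubgroup WeierstrassCurve NumberField IsDedekindDomain Field
  Literature.NumberTheory.EllipticCurves
  Literature.NumberTheory.GaloisRepresentations
  Literature.NumberTheory.EllipticCurves.ModularForms
  Literature.NumberTheory.QuadraticFields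
  Literature.NumberTheory.EllipticCurves.Rank1Residual
  Literature.NumberTheory.EllipticCurves.Rank1Residual.Typed
  Literature.NumberTheory.EllipticCurves.Wuthrich2014
  Literature.NumberTheory.EllipticCurves.Disegni2020
  Literature.NumberTheory.EllipticCurves.GreenbergVatsal2000
  Literature.NumberTheory.GaloisCohomology
  Summit.BirchSwinnertonDyer.Rank1Residual
  Summit.BirchSwinnertonDyer.Rank1Residual.X2
  Summit.BirchSwinnertonDyer.BirchSwinnertonDyer.Theses
  Summit.BirchSwinnertonDyer.BirchSwinnertonDyer.Theorems.EisensteinPrimesMazurMCOnCellBTwistbackTwoStepDefs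
  Summit.BirchSwinnertonDyer.BirchSwinnertonDyer.Theorems.EisensteinPrimesMazurMCOnCellBTwistbackConnectedPartnerZigzag
  Summit.BirchSwinnertonDyer.BirchSwinnertonDyer.Theorems.EisensteinPrimesMazurMCOnCellBTwistbackConnectedPartnerClassData

namespace Summit.BirchSwinnertonDyer.BirchSwinnertonDyer.Theorems.EisensteinPrimesMazurMCOnCellBTwistbackStub67Supply

/-! ## §1. The «¬ sub-row» hypothesis of 6⁷ is idle modulo PUBLISHED facts -/

/-- **`S → T`: the hypothesis-free supply implies the registered stub 6⁷** (weakening; fact-free). `hS` is `S` («every X2b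
pair is Ш-unit-connected or partner-connected»), the conclusion is `T` = VERBATIM the statement of twistback v12's
`stub_offSubrow_connectedShaUnitOrPartner`. [folklore] -/
theorem stub67_of_supply
    (hS :
      ∀ (W : WeierstrassCurve ℚ) [W.IsElliptic] [W.IsGloballyMinimal] (p : ℕ) [Fact p.Prime],
        X2.CellB W p →
        (∃ (W₁ : WeierstrassCurve ℚ) (_ : W₁.IsElliptic) (_ : W₁.IsGloballyMinimal)
            (W'' : WeierstrassCurve ℚ) (_ : W''.IsElliptic) (_ : W''.IsGloballyMinimal)
            (Wc : WeierstrassCurve ℚ) (_ : Wc.IsElliptic) (_ : Wc.IsGloballyMinimal),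
            IsIsogenous W W₁ ∧
            Relation.ReflTransGen (fun A B : WeierstrassCurve ℚ ↦ TwoStepAt p A B ∨
              (TwoStepAt p B A ∧ ∃ (_ : B.IsElliptic) (_ : B.IsGloballyMinimal), X2.CellB B p)) W₁ W'' ∧
            IsIsogenous W'' Wc ∧
            ∃ q : ℚ, shaAn Wc = (q : ℂ) ∧ padicValRat p q = 0) ∨
        (∃ (W₁ : WeierstrassCurve ℚ) (_ : W₁.IsElliptic) (_ : W₁.IsGloballyMinimal)
            (U : WeierstrassCurve ℚ) (_ : U.IsElliptic) (_ : U.IsGloballyMinimal)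
            (W₀ : WeierstrassCurve ℚ) (_ : W₀.IsElliptic) (_ : W₀.IsGloballyMinimal),
            IsIsogenous W W₁ ∧
            Relation.ReflTransGen (fun A B : WeierstrassCurve ℚ ↦ TwoStepAt p A B ∨
              (TwoStepAt p B A ∧ ∃ (_ : B.IsElliptic) (_ : B.IsGloballyMinimal), X2.CellB B p)) W₁ U ∧
            IsIsogenous U W₀ ∧
            ∃ (K : Type) (_ : Field K) (_ : NumberField K), IsImaginaryQuadratic K ∧
              SatisfiesHeegnerHypothesis (W₀.conductorNorm ℤ) K ∧ SatisfiesHeegnerHypothesis p K ∧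
              Odd (NumberField.discr K) ∧ NumberField.discr K < -4 ∧
              (W₀.quadraticTwist (NumberField.discr K : ℚ)).analyticRank = 1 ∧
              ∀ (Wd : WeierstrassCurve ℚ) [Wd.IsElliptic] [Wd.IsGloballyMinimal],
                (∃ C : VariableChange ℚ, C • Wd = W₀.quadraticTwist (NumberField.discr K : ℚ)) →
                MissingUpperBoundAt Wd p)) :
    ∀ (W : WeierstrassCurve ℚ) [W.IsElliptic] [W.IsGloballyMinimal] (p : ℕ) [Fact p.Prime],
      X2.CellB W p →
      ¬ (p = 3 ∧ ¬ W.HasSplitMultiplicativeReductionAtPrime 3 ∧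
          ∃ (Φ₀ : AddSubgroup (geomTorsion W (3 : ℤ))) (m : ℕ) (_ : NeZero m) (φ : DirichletCharacter (ZMod 3) m)
            (d : ℕ) (_ : NeZero d) (ψ : DirichletCharacter (ZMod 3) d) (S₀ : Finset (HeightOneSpectrum (𝓞 ℚ))),
            IsRationalLine W 3 Φ₀ ∧ φ.IsPrimitive ∧ ψ.IsPrimitive ∧
            (∀ (σ : absoluteGaloisGroup ℚ), ∀ P ∈ Φ₀,
              σ • P = (φ ((modNCyclotomicCharacter ℚ m σ : (ZMod m)ˣ) : ZMod m)).val • P) ∧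
            (∀ (σ : absoluteGaloisGroup ℚ) (P : geomTorsion W (3 : ℤ)),
              σ • P - (ψ ((modNCyclotomicCharacter ℚ d σ : (ZMod d)ˣ) : ZMod d)).val • P ∈ Φ₀) ∧
            (∀ v ∈ S₀, ((3 : ℕ) : 𝓞 ℚ) ∉ v.asIdeal) ∧
            (∀ v : HeightOneSpectrum (𝓞 ℚ), v ∉ S₀ → ((3 : ℕ) : 𝓞 ℚ) ∉ v.asIdeal → W.HasGoodReductionAt v) ∧
            1 + ∑ v ∈ S₀, delta W 3 v =
              ∑ v ∈ S₀, ((if φ (Rat.HeightOneSpectrum.natGenerator v : ZMod m) =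
                    (Rat.HeightOneSpectrum.natGenerator v : ZMod 3)
                  then sFactor 3 (Rat.HeightOneSpectrum.natGenerator v) else 0) +
                (if ψ (Rat.HeightOneSpectrum.natGenerator v : ZMod d) =
                    (Rat.HeightOneSpectrum.natGenerator v : ZMod 3)
                  then sFactor 3 (Rat.HeightOneSpectrum.natGenerator v) else 0))) →
      (∃ (W₁ : WeierstrassCurve ℚ) (_ : W₁.IsElliptic) (_ : W₁.IsGloballyMinimal)
          (W'' : WeierstrassCurve ℚ) (_ : W''.IsElliptic) (_ : W''.IsGloballyMinimal)
          (Wc : WeierstrassCurve ℚ) (_ : Wc.IsElliptic) (_ : Wc.IsGloballyMinimal),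
          IsIsogenous W W₁ ∧
          Relation.ReflTransGen (fun A B : WeierstrassCurve ℚ ↦ TwoStepAt p A B ∨
            (TwoStepAt p B A ∧ ∃ (_ : B.IsElliptic) (_ : B.IsGloballyMinimal), X2.CellB B p)) W₁ W'' ∧
          IsIsogenous W'' Wc ∧
          ∃ q : ℚ, shaAn Wc = (q : ℂ) ∧ padicValRat p q = 0) ∨
      (∃ (W₁ : WeierstrassCurve ℚ) (_ : W₁.IsElliptic) (_ : W₁.IsGloballyMinimal)
          (U : WeierstrassCurve ℚ) (_ : U.IsElliptic) (_ : U.IsGloballyMinimal)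
          (W₀ : WeierstrassCurve ℚ) (_ : W₀.IsElliptic) (_ : W₀.IsGloballyMinimal),
          IsIsogenous W W₁ ∧
          Relation.ReflTransGen (fun A B : WeierstrassCurve ℚ ↦ TwoStepAt p A B ∨
            (TwoStepAt p B A ∧ ∃ (_ : B.IsElliptic) (_ : B.IsGloballyMinimal), X2.CellB B p)) W₁ U ∧
          IsIsogenous U W₀ ∧
          ∃ (K : Type) (_ : Field K) (_ : NumberField K), IsImaginaryQuadratic K ∧
            SatisfiesHeegnerHypothesis (W₀.conductorNorm ℤ) K ∧ SatisfiesHeegnerHypothesis p K ∧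
            Odd (NumberField.discr K) ∧ NumberField.discr K < -4 ∧
            (W₀.quadraticTwist (NumberField.discr K : ℚ)).analyticRank = 1 ∧
            ∀ (Wd : WeierstrassCurve ℚ) [Wd.IsElliptic] [Wd.IsGloballyMinimal],
              (∃ C : VariableChange ℚ, C • Wd = W₀.quadraticTwist (NumberField.discr K : ℚ)) →
              MissingUpperBoundAt Wd p) := by
  intro W _ _ p _ hc _
  exact hS W p hc

/-- **`T → S` given PUBLISHED facts: on the closed sub-row the right disjunct holds AT the pair.** If `(W, 3)` is X2b,
`3` non-split and the local-balance-one line datum holds, x2-p1-w3 g11's p661280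
`upperPartner_at_three_of_balanceOne_of_padicGZ` (through p679233 §3 `connectedPartner_of_subrow`) gives a good partner at
`W` itself — the partnered-vertex datum with `W₁ = U = W₀ = W` and the empty zig-zag; off the sub-row `T` applies. Inputs BY
NAME, all PUBLISHED: `PublishedInputs` (item -19037), Disegni Thm. 4(1) (`padicBSD_rankOne_nonsplitMult`), Greenberg–Vatsal
(3.11) (`thm311_…`), Disegni Thm. 2.4 (`padicGrossZagier_nonsplitMult`), Nakagawa–Horie–Taya. CONDITIONAL on them; `T` is a
HYPOTHESIS (the registered open stub) — nothing is proved about it. [cite: GreenbergVatsal2000, §3 Thm. (3.11)]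
[cite: NakagawaHorie1988, Thm. 1] [cite: Disegni2020, §2.2 Thm. 2.4 and §3.2 Thm. 4] -/
theorem supply_of_stub67 (hP : EisensteinPrimes.PublishedInputs)
    (hDis : padicBSD_rankOne_nonsplitMult) (h311 : thm311_hasUnitContent_iff_and_order_eq_of_lineRamifiedEven)
    (hDGZ : padicGrossZagier_nonsplitMult)
    (hNHT : Literature.NumberTheory.QuadraticFields.nakagawaHorie_taya_exists_imaginary_h3_eq_one)
    (hT :
      ∀ (W : WeierstrassCurve ℚ) [W.IsElliptic] [W.IsGloballyMinimal] (p : ℕ) [Fact p.Prime],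
        X2.CellB W p →
        ¬ (p = 3 ∧ ¬ W.HasSplitMultiplicativeReductionAtPrime 3 ∧
            ∃ (Φ₀ : AddSubgroup (geomTorsion W (3 : ℤ))) (m : ℕ) (_ : NeZero m) (φ : DirichletCharacter (ZMod 3) m)
              (d : ℕ) (_ : NeZero d) (ψ : DirichletCharacter (ZMod 3) d) (S₀ : Finset (HeightOneSpectrum (𝓞 ℚ))),
              IsRationalLine W 3 Φ₀ ∧ φ.IsPrimitive ∧ ψ.IsPrimitive ∧
              (∀ (σ : absoluteGaloisGroup ℚ), ∀ P ∈ Φ₀,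
                σ • P = (φ ((modNCyclotomicCharacter ℚ m σ : (ZMod m)ˣ) : ZMod m)).val • P) ∧
              (∀ (σ : absoluteGaloisGroup ℚ) (P : geomTorsion W (3 : ℤ)),
                σ • P - (ψ ((modNCyclotomicCharacter ℚ d σ : (ZMod d)ˣ) : ZMod d)).val • P ∈ Φ₀) ∧
              (∀ v ∈ S₀, ((3 : ℕ) : 𝓞 ℚ) ∉ v.asIdeal) ∧
              (∀ v : HeightOneSpectrum (𝓞 ℚ), v ∉ S₀ → ((3 : ℕ) : 𝓞 ℚ) ∉ v.asIdeal → W.HasGoodReductionAt v) ∧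
              1 + ∑ v ∈ S₀, delta W 3 v =
                ∑ v ∈ S₀, ((if φ (Rat.HeightOneSpectrum.natGenerator v : ZMod m) =
                      (Rat.HeightOneSpectrum.natGenerator v : ZMod 3)
                    then sFactor 3 (Rat.HeightOneSpectrum.natGenerator v) else 0) +
                  (if ψ (Rat.HeightOneSpectrum.natGenerator v : ZMod d) =
                      (Rat.HeightOneSpectrum.natGenerator v : ZMod 3)
                    then sFactor 3 (Rat.HeightOneSpectrum.natGenerator v) else 0))) →
        (∃ (W₁ : WeierstrassCurve ℚ) (_ : W₁.IsElliptic) (_ : W₁.IsGloballyMinimal)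
            (W'' : WeierstrassCurve ℚ) (_ : W''.IsElliptic) (_ : W''.IsGloballyMinimal)
            (Wc : WeierstrassCurve ℚ) (_ : Wc.IsElliptic) (_ : Wc.IsGloballyMinimal),
            IsIsogenous W W₁ ∧
            Relation.ReflTransGen (fun A B : WeierstrassCurve ℚ ↦ TwoStepAt p A B ∨
              (TwoStepAt p B A ∧ ∃ (_ : B.IsElliptic) (_ : B.IsGloballyMinimal), X2.CellB B p)) W₁ W'' ∧
            IsIsogenous W'' Wc ∧
            ∃ q : ℚ, shaAn Wc = (q : ℂ) ∧ padicValRat p q = 0) ∨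
        (∃ (W₁ : WeierstrassCurve ℚ) (_ : W₁.IsElliptic) (_ : W₁.IsGloballyMinimal)
            (U : WeierstrassCurve ℚ) (_ : U.IsElliptic) (_ : U.IsGloballyMinimal)
            (W₀ : WeierstrassCurve ℚ) (_ : W₀.IsElliptic) (_ : W₀.IsGloballyMinimal),
            IsIsogenous W W₁ ∧
            Relation.ReflTransGen (fun A B : WeierstrassCurve ℚ ↦ TwoStepAt p A B ∨
              (TwoStepAt p B A ∧ ∃ (_ : B.IsElliptic) (_ : B.IsGloballyMinimal), X2.CellB B p)) W₁ U ∧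
            IsIsogenous U W₀ ∧
            ∃ (K : Type) (_ : Field K) (_ : NumberField K), IsImaginaryQuadratic K ∧
              SatisfiesHeegnerHypothesis (W₀.conductorNorm ℤ) K ∧ SatisfiesHeegnerHypothesis p K ∧
              Odd (NumberField.discr K) ∧ NumberField.discr K < -4 ∧
              (W₀.quadraticTwist (NumberField.discr K : ℚ)).analyticRank = 1 ∧
              ∀ (Wd : WeierstrassCurve ℚ) [Wd.IsElliptic] [Wd.IsGloballyMinimal],
                (∃ C : VariableChange ℚ, C • Wd = W₀.quadraticTwist (NumberField.discr K : ℚ)) →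
                MissingUpperBoundAt Wd p)) :
    ∀ (W : WeierstrassCurve ℚ) [W.IsElliptic] [W.IsGloballyMinimal] (p : ℕ) [Fact p.Prime],
      X2.CellB W p →
      (∃ (W₁ : WeierstrassCurve ℚ) (_ : W₁.IsElliptic) (_ : W₁.IsGloballyMinimal)
          (W'' : WeierstrassCurve ℚ) (_ : W''.IsElliptic) (_ : W''.IsGloballyMinimal)
          (Wc : WeierstrassCurve ℚ) (_ : Wc.IsElliptic) (_ : Wc.IsGloballyMinimal),
          IsIsogenous W W₁ ∧
          Relation.ReflTransGen (fun A B : WeierstrassCurve ℚ ↦ TwoStepAt p A B ∨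
            (TwoStepAt p B A ∧ ∃ (_ : B.IsElliptic) (_ : B.IsGloballyMinimal), X2.CellB B p)) W₁ W'' ∧
          IsIsogenous W'' Wc ∧
          ∃ q : ℚ, shaAn Wc = (q : ℂ) ∧ padicValRat p q = 0) ∨
      (∃ (W₁ : WeierstrassCurve ℚ) (_ : W₁.IsElliptic) (_ : W₁.IsGloballyMinimal)
          (U : WeierstrassCurve ℚ) (_ : U.IsElliptic) (_ : U.IsGloballyMinimal)
          (W₀ : WeierstrassCurve ℚ) (_ : W₀.IsElliptic) (_ : W₀.IsGloballyMinimal),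
          IsIsogenous W W₁ ∧
          Relation.ReflTransGen (fun A B : WeierstrassCurve ℚ ↦ TwoStepAt p A B ∨
            (TwoStepAt p B A ∧ ∃ (_ : B.IsElliptic) (_ : B.IsGloballyMinimal), X2.CellB B p)) W₁ U ∧
          IsIsogenous U W₀ ∧
          ∃ (K : Type) (_ : Field K) (_ : NumberField K), IsImaginaryQuadratic K ∧
            SatisfiesHeegnerHypothesis (W₀.conductorNorm ℤ) K ∧ SatisfiesHeegnerHypothesis p K ∧
            Odd (NumberField.discr K) ∧ NumberField.discr K < -4 ∧
            (W₀.quadraticTwist (NumberField.discr K : ℚ)).analyticRank = 1 ∧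
            ∀ (Wd : WeierstrassCurve ℚ) [Wd.IsElliptic] [Wd.IsGloballyMinimal],
              (∃ C : VariableChange ℚ, C • Wd = W₀.quadraticTwist (NumberField.discr K : ℚ)) →
              MissingUpperBoundAt Wd p) := by
  intro W _ _ p _ hc
  by_contra hD
  refine hD (hT W p hc fun hsub ↦ ?_)
  obtain ⟨rfl, hns, hbal⟩ := hsub
  exact hD (Or.inr (connectedPartner_of_subrow hP hDis h311 hDGZ hNHT W hc hns hbal))

/-- **`S ↔ T` modulo PUBLISHED facts** (`supply_of_stub67`, `stub67_of_supply`): the registered open content of twistback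
v12 is exactly the hypothesis-free supply statement `S`. CONDITIONAL on the five published named facts; neither side is
proved. [cite: GreenbergVatsal2000, §3 Thm. (3.11)] [cite: Disegni2020, §2.2 Thm. 2.4 and §3.2 Thm. 4] -/
theorem supply_iff_stub67 (hP : EisensteinPrimes.PublishedInputs)
    (hDis : padicBSD_rankOne_nonsplitMult) (h311 : thm311_hasUnitContent_iff_and_order_eq_of_lineRamifiedEven)
    (hDGZ : padicGrossZagier_nonsplitMult)
    (hNHT : Literature.NumberTheory.QuadraticFields.nakagawaHorie_taya_exists_imaginary_h3_eq_one) :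
    (∀ (W : WeierstrassCurve ℚ) [W.IsElliptic] [W.IsGloballyMinimal] (p : ℕ) [Fact p.Prime],
      X2.CellB W p →
      (∃ (W₁ : WeierstrassCurve ℚ) (_ : W₁.IsElliptic) (_ : W₁.IsGloballyMinimal)
          (W'' : WeierstrassCurve ℚ) (_ : W''.IsElliptic) (_ : W''.IsGloballyMinimal)
          (Wc : WeierstrassCurve ℚ) (_ : Wc.IsElliptic) (_ : Wc.IsGloballyMinimal),
          IsIsogenous W W₁ ∧
          Relation.ReflTransGen (fun A B : WeierstrassCurve ℚ ↦ TwoStepAt p A B ∨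
            (TwoStepAt p B A ∧ ∃ (_ : B.IsElliptic) (_ : B.IsGloballyMinimal), X2.CellB B p)) W₁ W'' ∧
          IsIsogenous W'' Wc ∧
          ∃ q : ℚ, shaAn Wc = (q : ℂ) ∧ padicValRat p q = 0) ∨
      (∃ (W₁ : WeierstrassCurve ℚ) (_ : W₁.IsElliptic) (_ : W₁.IsGloballyMinimal)
          (U : WeierstrassCurve ℚ) (_ : U.IsElliptic) (_ : U.IsGloballyMinimal)
          (W₀ : WeierstrassCurve ℚ) (_ : W₀.IsElliptic) (_ : W₀.IsGloballyMinimal),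
          IsIsogenous W W₁ ∧
          Relation.ReflTransGen (fun A B : WeierstrassCurve ℚ ↦ TwoStepAt p A B ∨
            (TwoStepAt p B A ∧ ∃ (_ : B.IsElliptic) (_ : B.IsGloballyMinimal), X2.CellB B p)) W₁ U ∧
          IsIsogenous U W₀ ∧
          ∃ (K : Type) (_ : Field K) (_ : NumberField K), IsImaginaryQuadratic K ∧
            SatisfiesHeegnerHypothesis (W₀.conductorNorm ℤ) K ∧ SatisfiesHeegnerHypothesis p K ∧
            Odd (NumberField.discr K) ∧ NumberField.discr K < -4 ∧
            (W₀.quadraticTwist (NumberField.discr K : ℚ)).analyticRank = 1 ∧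
            ∀ (Wd : WeierstrassCurve ℚ) [Wd.IsElliptic] [Wd.IsGloballyMinimal],
              (∃ C : VariableChange ℚ, C • Wd = W₀.quadraticTwist (NumberField.discr K : ℚ)) →
              MissingUpperBoundAt Wd p)) ↔
    (∀ (W : WeierstrassCurve ℚ) [W.IsElliptic] [W.IsGloballyMinimal] (p : ℕ) [Fact p.Prime],
      X2.CellB W p →
      ¬ (p = 3 ∧ ¬ W.HasSplitMultiplicativeReductionAtPrime 3 ∧
          ∃ (Φ₀ : AddSubgroup (geomTorsion W (3 : ℤ))) (m : ℕ) (_ : NeZero m) (φ : DirichletCharacter (ZMod 3) m)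
            (d : ℕ) (_ : NeZero d) (ψ : DirichletCharacter (ZMod 3) d) (S₀ : Finset (HeightOneSpectrum (𝓞 ℚ))),
            IsRationalLine W 3 Φ₀ ∧ φ.IsPrimitive ∧ ψ.IsPrimitive ∧
            (∀ (σ : absoluteGaloisGroup ℚ), ∀ P ∈ Φ₀,
              σ • P = (φ ((modNCyclotomicCharacter ℚ m σ : (ZMod m)ˣ) : ZMod m)).val • P) ∧
            (∀ (σ : absoluteGaloisGroup ℚ) (P : geomTorsion W (3 : ℤ)),
              σ • P - (ψ ((modNCyclotomicCharacter ℚ d σ : (ZMod d)ˣ) : ZMod d)).val • P ∈ Φ₀) ∧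
            (∀ v ∈ S₀, ((3 : ℕ) : 𝓞 ℚ) ∉ v.asIdeal) ∧
            (∀ v : HeightOneSpectrum (𝓞 ℚ), v ∉ S₀ → ((3 : ℕ) : 𝓞 ℚ) ∉ v.asIdeal → W.HasGoodReductionAt v) ∧
            1 + ∑ v ∈ S₀, delta W 3 v =
              ∑ v ∈ S₀, ((if φ (Rat.HeightOneSpectrum.natGenerator v : ZMod m) =
                    (Rat.HeightOneSpectrum.natGenerator v : ZMod 3)
                  then sFactor 3 (Rat.HeightOneSpectrum.natGenerator v) else 0) +
                (if ψ (Rat.HeightOneSpectrum.natGenerator v : ZMod d) =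
                    (Rat.HeightOneSpectrum.natGenerator v : ZMod 3)
                  then sFactor 3 (Rat.HeightOneSpectrum.natGenerator v) else 0))) →
      (∃ (W₁ : WeierstrassCurve ℚ) (_ : W₁.IsElliptic) (_ : W₁.IsGloballyMinimal)
          (W'' : WeierstrassCurve ℚ) (_ : W''.IsElliptic) (_ : W''.IsGloballyMinimal)
          (Wc : WeierstrassCurve ℚ) (_ : Wc.IsElliptic) (_ : Wc.IsGloballyMinimal),
          IsIsogenous W W₁ ∧
          Relation.ReflTransGen (fun A B : WeierstrassCurve ℚ ↦ TwoStepAt p A B ∨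
            (TwoStepAt p B A ∧ ∃ (_ : B.IsElliptic) (_ : B.IsGloballyMinimal), X2.CellB B p)) W₁ W'' ∧
          IsIsogenous W'' Wc ∧
          ∃ q : ℚ, shaAn Wc = (q : ℂ) ∧ padicValRat p q = 0) ∨
      (∃ (W₁ : WeierstrassCurve ℚ) (_ : W₁.IsElliptic) (_ : W₁.IsGloballyMinimal)
          (U : WeierstrassCurve ℚ) (_ : U.IsElliptic) (_ : U.IsGloballyMinimal)
          (W₀ : WeierstrassCurve ℚ) (_ : W₀.IsElliptic) (_ : W₀.IsGloballyMinimal),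
          IsIsogenous W W₁ ∧
          Relation.ReflTransGen (fun A B : WeierstrassCurve ℚ ↦ TwoStepAt p A B ∨
            (TwoStepAt p B A ∧ ∃ (_ : B.IsElliptic) (_ : B.IsGloballyMinimal), X2.CellB B p)) W₁ U ∧
          IsIsogenous U W₀ ∧
          ∃ (K : Type) (_ : Field K) (_ : NumberField K), IsImaginaryQuadratic K ∧
            SatisfiesHeegnerHypothesis (W₀.conductorNorm ℤ) K ∧ SatisfiesHeegnerHypothesis p K ∧
            Odd (NumberField.discr K) ∧ NumberField.discr K < -4 ∧
            (W₀.quadraticTwist (NumberField.discr K : ℚ)).analyticRank = 1 ∧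
            ∀ (Wd : WeierstrassCurve ℚ) [Wd.IsElliptic] [Wd.IsGloballyMinimal],
              (∃ C : VariableChange ℚ, C • Wd = W₀.quadraticTwist (NumberField.discr K : ℚ)) →
              MissingUpperBoundAt Wd p)) :=
  ⟨stub67_of_supply, supply_of_stub67 hP hDis h311 hDGZ hNHT⟩

/-! ## §2. The per-component form: 6⁷ from one display per reachable vertex -/

/-- **`T` from REACHABILITY of a display**: if every X2b pair `(W, p)` off the sub-row reaches, along a zig-zag `W ⇝ U` of the
v10 relation, SOME globally minimal `U` at which 6⁷'s conclusion holds (a Ш-unit class or a partnered vertex connected to the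
class of `U`), then `T` — F2g §2 `connectedShaUnit_or_connectedPartner_of_zigzag` carries the disjunction back to `W`. With
F2g's `…_of_zigzag_of_cellB` / `…_of_isIsogenous` the display may sit at any vertex of `W`'s component, reached in either
direction or up to isogeny. Conditional on `hmodN` only; the reachability hypothesis is the open supply in per-component
form — nothing is proved about it. [folklore] [cite: GreenbergVatsal2000, Thm. (1.3) and §2 p. 28] -/
theorem stub67_of_forall_exists_zigzag (hmodN : nonempty_modularParametrizationData)
    (h :
      ∀ (W : WeierstrassCurve ℚ) [W.IsElliptic] [W.IsGloballyMinimal] (p : ℕ) [Fact p.Prime],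
        X2.CellB W p →
        ¬ (p = 3 ∧ ¬ W.HasSplitMultiplicativeReductionAtPrime 3 ∧
            ∃ (Φ₀ : AddSubgroup (geomTorsion W (3 : ℤ))) (m : ℕ) (_ : NeZero m) (φ : DirichletCharacter (ZMod 3) m)
              (d : ℕ) (_ : NeZero d) (ψ : DirichletCharacter (ZMod 3) d) (S₀ : Finset (HeightOneSpectrum (𝓞 ℚ))),
              IsRationalLine W 3 Φ₀ ∧ φ.IsPrimitive ∧ ψ.IsPrimitive ∧
              (∀ (σ : absoluteGaloisGroup ℚ), ∀ P ∈ Φ₀,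
                σ • P = (φ ((modNCyclotomicCharacter ℚ m σ : (ZMod m)ˣ) : ZMod m)).val • P) ∧
              (∀ (σ : absoluteGaloisGroup ℚ) (P : geomTorsion W (3 : ℤ)),
                σ • P - (ψ ((modNCyclotomicCharacter ℚ d σ : (ZMod d)ˣ) : ZMod d)).val • P ∈ Φ₀) ∧
              (∀ v ∈ S₀, ((3 : ℕ) : 𝓞 ℚ) ∉ v.asIdeal) ∧
              (∀ v : HeightOneSpectrum (𝓞 ℚ), v ∉ S₀ → ((3 : ℕ) : 𝓞 ℚ) ∉ v.asIdeal → W.HasGoodReductionAt v) ∧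
              1 + ∑ v ∈ S₀, delta W 3 v =
                ∑ v ∈ S₀, ((if φ (Rat.HeightOneSpectrum.natGenerator v : ZMod m) =
                      (Rat.HeightOneSpectrum.natGenerator v : ZMod 3)
                    then sFactor 3 (Rat.HeightOneSpectrum.natGenerator v) else 0) +
                  (if ψ (Rat.HeightOneSpectrum.natGenerator v : ZMod d) =
                      (Rat.HeightOneSpectrum.natGenerator v : ZMod 3)
                    then sFactor 3 (Rat.HeightOneSpectrum.natGenerator v) else 0))) →
          ∃ (U : WeierstrassCurve ℚ) (_ : U.IsElliptic) (_ : U.IsGloballyMinimal),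
            Relation.ReflTransGen (fun A B : WeierstrassCurve ℚ ↦ TwoStepAt p A B ∨
              (TwoStepAt p B A ∧ ∃ (_ : B.IsElliptic) (_ : B.IsGloballyMinimal), X2.CellB B p)) W U ∧
            ((∃ (U₁ : WeierstrassCurve ℚ) (_ : U₁.IsElliptic) (_ : U₁.IsGloballyMinimal)
                (U'' : WeierstrassCurve ℚ) (_ : U''.IsElliptic) (_ : U''.IsGloballyMinimal)
                (Uc : WeierstrassCurve ℚ) (_ : Uc.IsElliptic) (_ : Uc.IsGloballyMinimal),
                IsIsogenous U U₁ ∧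
                Relation.ReflTransGen (fun A B : WeierstrassCurve ℚ ↦ TwoStepAt p A B ∨
                  (TwoStepAt p B A ∧ ∃ (_ : B.IsElliptic) (_ : B.IsGloballyMinimal), X2.CellB B p)) U₁ U'' ∧
                IsIsogenous U'' Uc ∧
                ∃ q : ℚ, shaAn Uc = (q : ℂ) ∧ padicValRat p q = 0) ∨
            (∃ (U₁ : WeierstrassCurve ℚ) (_ : U₁.IsElliptic) (_ : U₁.IsGloballyMinimal)
                (U' : WeierstrassCurve ℚ) (_ : U'.IsElliptic) (_ : U'.IsGloballyMinimal)
                (W₀ : WeierstrassCurve ℚ) (_ : W₀.IsElliptic) (_ : W₀.IsGloballyMinimal),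
                IsIsogenous U U₁ ∧
                Relation.ReflTransGen (fun A B : WeierstrassCurve ℚ ↦ TwoStepAt p A B ∨
                  (TwoStepAt p B A ∧ ∃ (_ : B.IsElliptic) (_ : B.IsGloballyMinimal), X2.CellB B p)) U₁ U' ∧
                IsIsogenous U' W₀ ∧
                ∃ (K : Type) (_ : Field K) (_ : NumberField K), IsImaginaryQuadratic K ∧
                  SatisfiesHeegnerHypothesis (W₀.conductorNorm ℤ) K ∧ SatisfiesHeegnerHypothesis p K ∧
                  Odd (NumberField.discr K) ∧ NumberField.discr K < -4 ∧
                  (W₀.quadraticTwist (NumberField.discr K : ℚ)).analyticRank = 1 ∧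
                  ∀ (Wd : WeierstrassCurve ℚ) [Wd.IsElliptic] [Wd.IsGloballyMinimal],
                    (∃ C : VariableChange ℚ, C • Wd = W₀.quadraticTwist (NumberField.discr K : ℚ)) →
                    MissingUpperBoundAt Wd p))) :
    ∀ (W : WeierstrassCurve ℚ) [W.IsElliptic] [W.IsGloballyMinimal] (p : ℕ) [Fact p.Prime],
      X2.CellB W p →
      ¬ (p = 3 ∧ ¬ W.HasSplitMultiplicativeReductionAtPrime 3 ∧
          ∃ (Φ₀ : AddSubgroup (geomTorsion W (3 : ℤ))) (m : ℕ) (_ : NeZero m) (φ : DirichletCharacter (ZMod 3) m)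
            (d : ℕ) (_ : NeZero d) (ψ : DirichletCharacter (ZMod 3) d) (S₀ : Finset (HeightOneSpectrum (𝓞 ℚ))),
            IsRationalLine W 3 Φ₀ ∧ φ.IsPrimitive ∧ ψ.IsPrimitive ∧
            (∀ (σ : absoluteGaloisGroup ℚ), ∀ P ∈ Φ₀,
              σ • P = (φ ((modNCyclotomicCharacter ℚ m σ : (ZMod m)ˣ) : ZMod m)).val • P) ∧
            (∀ (σ : absoluteGaloisGroup ℚ) (P : geomTorsion W (3 : ℤ)),
              σ • P - (ψ ((modNCyclotomicCharacter ℚ d σ : (ZMod d)ˣ) : ZMod d)).val • P ∈ Φ₀) ∧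
            (∀ v ∈ S₀, ((3 : ℕ) : 𝓞 ℚ) ∉ v.asIdeal) ∧
            (∀ v : HeightOneSpectrum (𝓞 ℚ), v ∉ S₀ → ((3 : ℕ) : 𝓞 ℚ) ∉ v.asIdeal → W.HasGoodReductionAt v) ∧
            1 + ∑ v ∈ S₀, delta W 3 v =
              ∑ v ∈ S₀, ((if φ (Rat.HeightOneSpectrum.natGenerator v : ZMod m) =
                    (Rat.HeightOneSpectrum.natGenerator v : ZMod 3)
                  then sFactor 3 (Rat.HeightOneSpectrum.natGenerator v) else 0) +
                (if ψ (Rat.HeightOneSpectrum.natGenerator v : ZMod d) =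
                    (Rat.HeightOneSpectrum.natGenerator v : ZMod 3)
                  then sFactor 3 (Rat.HeightOneSpectrum.natGenerator v) else 0))) →
      (∃ (W₁ : WeierstrassCurve ℚ) (_ : W₁.IsElliptic) (_ : W₁.IsGloballyMinimal)
          (W'' : WeierstrassCurve ℚ) (_ : W''.IsElliptic) (_ : W''.IsGloballyMinimal)
          (Wc : WeierstrassCurve ℚ) (_ : Wc.IsElliptic) (_ : Wc.IsGloballyMinimal),
          IsIsogenous W W₁ ∧
          Relation.ReflTransGen (fun A B : WeierstrassCurve ℚ ↦ TwoStepAt p A B ∨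
            (TwoStepAt p B A ∧ ∃ (_ : B.IsElliptic) (_ : B.IsGloballyMinimal), X2.CellB B p)) W₁ W'' ∧
          IsIsogenous W'' Wc ∧
          ∃ q : ℚ, shaAn Wc = (q : ℂ) ∧ padicValRat p q = 0) ∨
      (∃ (W₁ : WeierstrassCurve ℚ) (_ : W₁.IsElliptic) (_ : W₁.IsGloballyMinimal)
          (U : WeierstrassCurve ℚ) (_ : U.IsElliptic) (_ : U.IsGloballyMinimal)
          (W₀ : WeierstrassCurve ℚ) (_ : W₀.IsElliptic) (_ : W₀.IsGloballyMinimal),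
          IsIsogenous W W₁ ∧
          Relation.ReflTransGen (fun A B : WeierstrassCurve ℚ ↦ TwoStepAt p A B ∨
            (TwoStepAt p B A ∧ ∃ (_ : B.IsElliptic) (_ : B.IsGloballyMinimal), X2.CellB B p)) W₁ U ∧
          IsIsogenous U W₀ ∧
          ∃ (K : Type) (_ : Field K) (_ : NumberField K), IsImaginaryQuadratic K ∧
            SatisfiesHeegnerHypothesis (W₀.conductorNorm ℤ) K ∧ SatisfiesHeegnerHypothesis p K ∧
            Odd (NumberField.discr K) ∧ NumberField.discr K < -4 ∧
            (W₀.quadraticTwist (NumberField.discr K : ℚ)).analyticRank = 1 ∧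
            ∀ (Wd : WeierstrassCurve ℚ) [Wd.IsElliptic] [Wd.IsGloballyMinimal],
              (∃ C : VariableChange ℚ, C • Wd = W₀.quadraticTwist (NumberField.discr K : ℚ)) →
              MissingUpperBoundAt Wd p) := by
  intro W _ _ p _ hc hsub
  obtain ⟨U, _, _, hz, hU⟩ := h W p hc hsub
  exact connectedShaUnit_or_connectedPartner_of_zigzag hmodN U hz hU

end Summit.BirchSwinnertonDyer.BirchSwinnertonDyer.Theorems.EisensteinPrimesMazurMCOnCellBTwistbackStub67Supply

end
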